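import Summits.ValiantsHypothesis.ValiantsHypothesis.Theorems.BarrierLeverAnchoredDoorHitsLowerPairsWApexLemma
import Summits.ValiantsHypothesis.ValiantsHypothesis.Theorems.BarrierLeverAnchoredDoorHitsLowerPairsSplitFamily

/-!
# Support item `AnchoredDoorHitsLowerPairs` (stmt-ValiantsHypothesis-22510), line `anchored-peeling`:
# THE WEIGHTED APEX RECURSION — weighted-apex-decomposable pairs are hit at profile 1; the registered residual minus weighted apex pairs

Helper file (`--supports stmt-ValiantsHypothesis-22510`; cell valiant-natproofs, rung V4, 𝒟-side door (c); registered line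
`Cruxes/AnchoredDoorHitsLowerPairs/Lines/anchored_peeling.lean` v25, registered residual `Stmt.stub_ltRestNonCanonRS`; prover seat val-np-p1 gen 25;
memo HOME/val-np-p1/g25/MEMO-weighted-apex-valnp1-g25.md). Closes NO item.

THE RECURSION (§1). `WApexDecomp R F` (inductive): `(∅, ∅)`, `({∅}, {∅})`, and `(R, F)` whenever a WEIGHTED apex step (apex `v⋆ ↦ x_n`, tail weights
`α : Fin h → ℂ`, root weights `β : Fin h → ℂ`, lifted columns `T` with chosen labels `λ`; hypotheses of `indepColsR_apexW`) has both halves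
`(delFam R n, delFam F v⋆ ∖ T)` and `(linkFam R n, linkFam F v⋆ ∪ λ(T))` decomposable. **THEOREM `exists_indepColsR_of_wApexDecomp`**: every
weighted-apex-decomposable pair has independent door columns for some doors; `WApexDecomp.card_eq`; the typed recursion of `…RelApexRecursion` is the
special case of indicator weights (`wApexDecomp_of_relApexDecomp`).

CONSEQUENCES (§2–§3). `symbolicDet_one_ne_zero_of_wApexDecomp` (weighted apex pairs are hit at PROFILE 1), `IsWApexPair ⊇ IsRelApexPair`
(`isWApexPair_of_isRelApexPair`); the NARROWED residuals: `Stmt.stub_wApexRest` (face-UQ residual minus weighted apex pairs either way) with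
`stub_relApexRest_of_wApexRest` and `anchoredDoorHitsLowerPairs_of_wApexRest` (route decl BY NAME); and, for the REGISTERED residual of record
(`Stmt.stub_ltRestNonCanonRS`, skeleton v25, restated verbatim), the weakening `Stmt.stub_ltRestNonCanonRSW` (its text plus «not a weighted apex pair in
either orientation») with the glue `stub_ltRestNonCanonRS_of_rsw` — a 1:1 weakest-node swap candidate for the planner.

REACH (memo §3, kernel-independent evidence, kit j323336/j323341): with signed tail weights the canonical pairs `D_2 = (R₃, K₇)`, `D_3 = (R₄, K₁₅)`,
the g21 exception #881 versus `cube₅` and `cube₇ − top` versus `tB(9,3)` — none relatively apex-decomposable with indicator weights — are weighted-apex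
decomposable (explicit trees found by search; e.g. `(R₃, K₇)`: split `x₃`, apex `y₀`, weights `+1` on `y₁..y₄`, `−1` on `y₅, y₆`, so that the 8 balanced
edges of `K_{4,2}` stay in the top block and the 7 unbalanced ones lift).

WHAT THIS IS NOT: `Stmt.stub_wApexRest` / `Stmt.stub_ltRestNonCanonRSW` are OPEN and not census-empty (`2^[5] ∗ 3pts` versus `tB(9,3)` has no weighted
split with weights in `{0, ±1, ±2, ±3}` at the top level; the deep-versus-wide residual persists at every fixed profile); nothing on crux
stmt-ValiantsHypothesis-14610 or on `VP` versus `VNP`.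
-/

set_option linter.dupNamespace false

namespace Summit.ValiantsHypothesis.ValiantsHypothesis.Theorems.BarrierLever.AnchoredPeeling

open Finset MvPolynomial
open Summit.ValiantsHypothesis.ValiantsHypothesis.Theorems.BarrierLever.BrickCalculus (pexpo pexpo_def pexpo_le_iff pexpo_sub
  pexpo_apply_castAdd pexpo_apply_natAdd)

noncomputable section

variable {h : ℕ}

/-! ## 1. Weighted-apex-decomposable pairs and the main theorem -/

/-- **Weighted-apex-decomposable pairs** `(R, F)`: `(∅, ∅)`, `({∅}, {∅})`, or split by a weighted apex step (hypotheses of `indepColsR_apexW`). -/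
inductive WApexDecomp : Finset (Finset (Fin h)) → Finset (Finset (Fin h)) → Prop
  | nil : WApexDecomp ∅ ∅
  | unit : WApexDecomp {∅} {∅}
  | step {n vs : Fin h} {R F T : Finset (Finset (Fin h))} {α β : Fin h → ℂ} {lam : Finset (Fin h) → Finset (Fin h)}
      (hTF : T ⊆ delFam F vs)
      (hsupp : ∀ Y ∈ delFam F vs, labelsW α β Y ⊆ linkFam F vs ∪ T.image lam)
      (hown : ∀ Y₀ ∈ T, ∀ Y ∈ delFam F vs, lam Y₀ ∈ labelsW α β Y → Y = Y₀)
      (hlamL : ∀ Y₀ ∈ T, lam Y₀ ∉ linkFam F vs)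
      (hlamT : ∀ Y₀ ∈ T, lam Y₀ ∈ labelsW α β Y₀)
      (h0 : WApexDecomp (delFam R n) (delFam F vs \ T))
      (h1 : WApexDecomp (linkFam R n) (linkFam F vs ∪ T.image lam)) :
      WApexDecomp R F

/-- The chosen labels are injective on the lifted columns. -/
theorem injOn_lam_of_ownW {F T : Finset (Finset (Fin h))} {vs : Fin h} {α β : Fin h → ℂ} {lam : Finset (Fin h) → Finset (Fin h)}
    (hTF : T ⊆ delFam F vs) (hown : ∀ Y₀ ∈ T, ∀ Y ∈ delFam F vs, lam Y₀ ∈ labelsW α β Y → Y = Y₀)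
    (hlamT : ∀ Y₀ ∈ T, lam Y₀ ∈ labelsW α β Y₀) : Set.InjOn lam ↑T := by
  intro Y₀ hY₀ Y₁ hY₁ heq
  have h' : lam Y₀ ∈ labelsW α β Y₁ := by rw [heq]; exact hlamT Y₁ hY₁
  exact (hown Y₀ hY₀ Y₁ (hTF hY₁) h').symm

/-- **Weighted-apex-decomposable pairs are square.** -/
theorem WApexDecomp.card_eq {R F : Finset (Finset (Fin h))} (hRF : WApexDecomp R F) : R.card = F.card := by
  classical
  induction hRF with
  | nil => rfl
  | unit => rfl
  | @step n vs R F T α β lam hTF hsupp hown hlamL hlamT h0 h1 ih0 ih1 =>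
    rw [← card_delFam_add_card_linkFam R n, ← card_delFam_add_card_linkFam F vs, ih0, ih1]
    have hdisj : Disjoint (linkFam F vs) (T.image lam) := by
      rw [Finset.disjoint_right]
      intro μ hμ hμL
      obtain ⟨Y₀, hY₀, rfl⟩ := Finset.mem_image.mp hμ
      exact hlamL Y₀ hY₀ hμL
    rw [Finset.card_sdiff_of_subset hTF, Finset.card_union_of_disjoint hdisj,
      Finset.card_image_of_injOn (injOn_lam_of_ownW hTF hown hlamT)]
    have := Finset.card_le_card hTF
    omega

/-- **MAIN THEOREM: weighted-apex-decomposable pairs have independent door columns for some doors.** -/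
theorem exists_indepColsR_of_wApexDecomp {R F : Finset (Finset (Fin h))} (hRF : WApexDecomp R F) :
    ∃ (θ : Fin h → Fin h → ℂ) (φ : Fin h → Fin h → Fin h → ℂ), IndepColsR R F θ φ := by
  classical
  induction hRF with
  | nil => exact ⟨fun _ _ => 0, fun _ _ _ => 0, fun g _ W hW => absurd hW (Finset.notMem_empty W)⟩
  | unit =>
    refine ⟨fun _ _ => 0, fun _ _ _ => 0, fun g hg W hW => ?_⟩
    rw [Finset.mem_singleton] at hW
    subst hW
    have := hg ∅ (Finset.mem_singleton_self ∅)
    rw [Finset.sum_singleton, Finset.prod_empty, MvPolynomial.coeff_one, if_pos (by simp [pexpo_def]), mul_one] at this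
    exact this
  | @step n vs R F T α β lam hTF hsupp hown hlamL hlamT h0 h1 ih0 ih1 =>
    obtain ⟨θ, φ, hI0, hI1⟩ := exists_indepColsR_and h0.card_eq h1.card_eq ih0 ih1
    refine ⟨apexThetaW (truncTheta n θ) vs n β, apexPhiW (truncPhi n φ) vs n α, ?_⟩
    refine indepColsR_apexW R F T α β lam hTF hsupp hown hlamL hlamT (fun γ => by simp [truncTheta]) (fun b γ => by simp [truncPhi]) ?_ ?_
    · exact (indepColsR_trunc_iff _ _ (fun U hU => (mem_delFam.mp hU).2) θ φ).mpr hI0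
    · exact (indepColsR_trunc_iff _ _ (fun U hU => (mem_linkFam.mp hU).1) θ φ).mpr hI1

/-- **The typed recursion is a special case:** `RelApexDecomp R F → WApexDecomp R F` (indicator weights). -/
theorem wApexDecomp_of_relApexDecomp {R F : Finset (Finset (Fin h))} (hRF : RelApexDecomp R F) : WApexDecomp R F := by
  classical
  induction hRF with
  | nil => exact WApexDecomp.nil
  | unit => exact WApexDecomp.unit
  | @step n vs R F T G₁ G₂ lam hTF hsupp hown hlamL hlamT h0 h1 ih0 ih1 =>
    refine WApexDecomp.step (n := n) (vs := vs) (T := T) (α := tailInd G₁) (β := rootInd G₂) (lam := lam) hTF ?_ ?_ hlamL ?_ ih0 ih1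
    · intro Y hY; rw [labelsW_indicator]; exact hsupp Y hY
    · intro Y₀ hY₀ Y hY hμ; rw [labelsW_indicator] at hμ; exact hown Y₀ hY₀ Y hY hμ
    · intro Y₀ hY₀; rw [labelsW_indicator]; exact hlamT Y₀ hY₀

/-! ## 2. The profile-1 hit and weighted apex pairs -/

/-- **A pair whose (row family, column family) is weighted-apex-decomposable is hit at profile 1** (the `ψ = 0` member). -/
theorem symbolicDet_one_ne_zero_of_wApexDecomp {r : ℕ} (u w : Fin r → Finset (Fin h)) (hw : Function.Injective w)
    (hF : WApexDecomp (Finset.univ.image u) (Finset.univ.image w)) : symbolicDet 1 h r u w ≠ 0 := by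
  classical
  obtain ⟨θ, φ, hI⟩ := exists_indepColsR_of_wApexDecomp hF
  have hdet := det_ne_zero_of_indepColsR hI u w
    (fun U hU => by obtain ⟨i, -, hi⟩ := Finset.mem_image.mp hU; exact ⟨i, hi⟩) hw
    (fun j => Finset.mem_image.mpr ⟨j, Finset.mem_univ j, rfl⟩)
  intro h0
  have hmap := congrArg (eval (mPoint θ φ)) h0
  rw [map_zero, symbolicDet, RingHom.map_det] at hmap
  apply hdet
  rw [← hmap]
  congr 1
  refine Matrix.ext (fun i j => ?_)
  rw [RingHom.mapMatrix_apply, Matrix.map_apply, Matrix.of_apply, Matrix.of_apply, ← pexpo_def, ← coeff_map, map_mPoint_symbolicWitness,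
    coeff_prod_cpart θ φ Finset.univ (u i) (w j) (Finset.subset_univ _)]

/-- A pair is a **weighted apex pair** if its (row family, column family) is weighted-apex-decomposable. -/
def IsWApexPair {r : ℕ} (u w : Fin r → Finset (Fin h)) : Prop :=
  WApexDecomp (Finset.univ.image u) (Finset.univ.image w)

/-- **Relative apex pairs are weighted apex pairs.** -/
theorem isWApexPair_of_isRelApexPair {r : ℕ} {u w : Fin r → Finset (Fin h)} (hP : IsRelApexPair u w) : IsWApexPair u w :=
  wApexDecomp_of_relApexDecomp hP

/-- **Weighted apex pairs are hit at every profile `s ≥ 1`.** -/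
theorem symbolicDet_ne_zero_of_isWApexPair {s : ℕ} (hs : 1 ≤ s) {r : ℕ} {u w : Fin r → Finset (Fin h)} (hw : Function.Injective w)
    (hP : IsWApexPair u w) : symbolicDet s h r u w ≠ 0 :=
  symbolicDet_ne_zero_mono hs (symbolicDet_one_ne_zero_of_wApexDecomp u w hw hP)

/-! ## 3. The narrowed residuals and the compositions by name -/

/-- **STUB TEXT (offered): THE WEIGHTED APEX REST.** At some fixed profile `s ≥ 1` and all `h ≥ h₀`: every injective simplicial-complex pair with `r ≥ 2`
rows, NO face-UQ data on either side, which is not a WEIGHTED apex pair in either orientation, has nonzero symbolic minor. WEAKER than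
`Stmt.stub_relApexRest` (indicator weights). WHY IT MIGHT FAIL: as for the relative apex rest — a data-free deep-versus-wide pair with no weighted
split at any variable (the zero-sum level sets of vertex weightings are rigid on 2-dimensional wide complexes: `2^[5] ∗ 3pts` versus `tB(9,3)`). -/
def Stmt.stub_wApexRest : Prop :=
  ∃ s h₀ : ℕ, 1 ≤ s ∧ ∀ h : ℕ, h₀ ≤ h → ∀ (r : ℕ) (u w : Fin r → Finset (Fin h)),
    Function.Injective u → Function.Injective w → IsLowerSet (Set.range u) → IsLowerSet (Set.range w) → 2 ≤ r →
    (∀ (a : Fin h) (W₀ : Finset (Fin h)) (𝒜 : Finset (Finset (Fin h))) (ρ : Finset (Fin h) → Finset (Fin h)), ¬ UQFData s u w a W₀ 𝒜 ρ) →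
    (∀ (c : Fin h) (Z : Finset (Fin h)) (𝒜 : Finset (Finset (Fin h))) (ρ : Finset (Fin h) → Finset (Fin h)), ¬ UQFData s w u c Z 𝒜 ρ) →
    ¬ IsWApexPair u w → ¬ IsWApexPair w u →
    symbolicDet s h r u w ≠ 0

/-- **Kernel narrowing: weighted apex rest ⟹ relative apex rest.** -/
theorem stub_relApexRest_of_wApexRest (hR : Stmt.stub_wApexRest) : Stmt.stub_relApexRest := by
  obtain ⟨s, h₀, hs, hR⟩ := hR
  refine ⟨s, h₀, hs, fun h hh r u w hu hw hlu hlw hr hx hy _ _ => ?_⟩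
  by_cases hrx : IsWApexPair u w
  · exact symbolicDet_ne_zero_of_isWApexPair hs hw hrx
  · by_cases hry : IsWApexPair w u
    · exact (symbolicDet_ne_zero_comm s h r u w).mpr (symbolicDet_ne_zero_of_isWApexPair hs hu hry)
    · exact hR h hh r u w hu hw hlu hlw hr hx hy hrx hry

/-- **Composition BY NAME: weighted apex rest ⟹ the support item `AnchoredDoorHitsLowerPairs`.** -/
theorem anchoredDoorHitsLowerPairs_of_wApexRest (hR : Stmt.stub_wApexRest) :
    Summit.ValiantsHypothesis.ValiantsHypothesis.Theses.BarrierLever.AnchoredDoorHitsLowerPairs :=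
  anchoredDoorHitsLowerPairs_of_relApexRest (stub_relApexRest_of_wApexRest hR)

/-- **THE REGISTERED RESIDUAL OF RECORD, restated verbatim** (skeleton v23–v25 `Stmt.stub_ltRestNonCanonRS`): the LT rest minus the relabelled canonical
and split pairs. -/
def Stmt.stub_ltRestNonCanonRS : Prop :=
  ∃ s h₀ : ℕ, 1 ≤ s ∧ ∀ h : ℕ, h₀ ≤ h → ∀ (r : ℕ) (u w : Fin r → Finset (Fin h)),
    Function.Injective u → Function.Injective w → IsLowerSet (Set.range u) → IsLowerSet (Set.range w) → 2 ≤ r →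
    (∀ (a : Fin h) (W₀ : Finset (Fin h)) (𝒜 : Finset (Finset (Fin h))) (ρ : Finset (Fin h) → Finset (Fin h)), ¬ UQFData s u w a W₀ 𝒜 ρ) →
    (∀ (c : Fin h) (Z : Finset (Fin h)) (𝒜 : Finset (Finset (Fin h))) (ρ : Finset (Fin h) → Finset (Fin h)), ¬ UQFData s w u c Z 𝒜 ρ) →
    ¬ Summit.ValiantsHypothesis.ValiantsHypothesis.Theorems.BarrierLever.AnchoredPeeling.IsRelApexPair u w → ¬ Summit.ValiantsHypothesis.ValiantsHypothesis.Theorems.BarrierLever.AnchoredPeeling.IsRelApexPair w u → ¬ Summit.ValiantsHypothesis.ValiantsHypothesis.Theorems.BarrierLever.AnchoredPeeling.LTCert u w → ¬ Summit.ValiantsHypothesis.ValiantsHypothesis.Theorems.BarrierLever.AnchoredPeeling.LTCert w u →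
    (¬ ∃ (k : ℕ) (σ τ : Equiv.Perm (Fin h)), 1 ≤ k ∧ 2 * k + 1 ≤ h ∧ 2 ^ (k + 1) - 1 ≤ h ∧
        (∀ U : Finset (Fin h), U ∈ Set.range u ↔ Summit.ValiantsHypothesis.ValiantsHypothesis.Theorems.BarrierLever.AnchoredPeeling.DecRow k h (U.map σ.toEmbedding)) ∧
        (∀ W : Finset (Fin h), W ∈ Set.range w ↔ Summit.ValiantsHypothesis.ValiantsHypothesis.Theorems.BarrierLever.AnchoredPeeling.DecCol k h (W.map τ.toEmbedding))) →
    (¬ ∃ (k : ℕ) (σ τ : Equiv.Perm (Fin h)), 1 ≤ k ∧ 2 * k + 1 ≤ h ∧ 2 ^ (k + 1) - 1 ≤ h ∧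
        (∀ U : Finset (Fin h), U ∈ Set.range w ↔ Summit.ValiantsHypothesis.ValiantsHypothesis.Theorems.BarrierLever.AnchoredPeeling.DecRow k h (U.map σ.toEmbedding)) ∧
        (∀ W : Finset (Fin h), W ∈ Set.range u ↔ Summit.ValiantsHypothesis.ValiantsHypothesis.Theorems.BarrierLever.AnchoredPeeling.DecCol k h (W.map τ.toEmbedding))) →
    (¬ ∃ (m : ℕ) (σ τ : Equiv.Perm (Fin h)), 1 ≤ m ∧ 2 * m + 2 ≤ h ∧ 2 ^ (m + 1) + 2 ^ m - 1 ≤ h ∧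
        (∀ U : Finset (Fin h), U ∈ Set.range u ↔ Summit.ValiantsHypothesis.ValiantsHypothesis.Theorems.BarrierLever.AnchoredPeeling.SplitRow m h (U.map σ.toEmbedding)) ∧
        (∀ W : Finset (Fin h), W ∈ Set.range w ↔ Summit.ValiantsHypothesis.ValiantsHypothesis.Theorems.BarrierLever.AnchoredPeeling.SplitCol m h (W.map τ.toEmbedding))) →
    (¬ ∃ (m : ℕ) (σ τ : Equiv.Perm (Fin h)), 1 ≤ m ∧ 2 * m + 2 ≤ h ∧ 2 ^ (m + 1) + 2 ^ m - 1 ≤ h ∧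
        (∀ U : Finset (Fin h), U ∈ Set.range w ↔ Summit.ValiantsHypothesis.ValiantsHypothesis.Theorems.BarrierLever.AnchoredPeeling.SplitRow m h (U.map σ.toEmbedding)) ∧
        (∀ W : Finset (Fin h), W ∈ Set.range u ↔ Summit.ValiantsHypothesis.ValiantsHypothesis.Theorems.BarrierLever.AnchoredPeeling.SplitCol m h (W.map τ.toEmbedding))) →
    symbolicDet s h r u w ≠ 0

/-- **STUB TEXT (offered, v26 candidate): THE REGISTERED RESIDUAL MINUS WEIGHTED APEX PAIRS.** The text of `Stmt.stub_ltRestNonCanonRS` VERBATIM plus two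
exclusions: the pair is not a weighted apex pair in either orientation. WEAKER than `Stmt.stub_ltRestNonCanonRS` (glue `stub_ltRestNonCanonRS_of_rsw`).
WHY IT MIGHT FAIL: a data-free, LT-free, non-canonical, non-split pair admitting no weighted apex split on either side whose symbolic minor vanishes at
the chosen profile — `2^[5] ∗ 3pts` versus `tB(9,3)` is the smallest known pair outside all the kernel classes at profile 1 (numerically alive). -/
def Stmt.stub_ltRestNonCanonRSW : Prop :=
  ∃ s h₀ : ℕ, 1 ≤ s ∧ ∀ h : ℕ, h₀ ≤ h → ∀ (r : ℕ) (u w : Fin r → Finset (Fin h)),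
    Function.Injective u → Function.Injective w → IsLowerSet (Set.range u) → IsLowerSet (Set.range w) → 2 ≤ r →
    (∀ (a : Fin h) (W₀ : Finset (Fin h)) (𝒜 : Finset (Finset (Fin h))) (ρ : Finset (Fin h) → Finset (Fin h)), ¬ UQFData s u w a W₀ 𝒜 ρ) →
    (∀ (c : Fin h) (Z : Finset (Fin h)) (𝒜 : Finset (Finset (Fin h))) (ρ : Finset (Fin h) → Finset (Fin h)), ¬ UQFData s w u c Z 𝒜 ρ) →
    ¬ Summit.ValiantsHypothesis.ValiantsHypothesis.Theorems.BarrierLever.AnchoredPeeling.IsRelApexPair u w → ¬ Summit.ValiantsHypothesis.ValiantsHypothesis.Theorems.BarrierLever.AnchoredPeeling.IsRelApexPair w u → ¬ Summit.ValiantsHypothesis.ValiantsHypothesis.Theorems.BarrierLever.AnchoredPeeling.LTCert u w → ¬ Summit.ValiantsHypothesis.ValiantsHypothesis.Theorems.BarrierLever.AnchoredPeeling.LTCert w u →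
    (¬ ∃ (k : ℕ) (σ τ : Equiv.Perm (Fin h)), 1 ≤ k ∧ 2 * k + 1 ≤ h ∧ 2 ^ (k + 1) - 1 ≤ h ∧
        (∀ U : Finset (Fin h), U ∈ Set.range u ↔ Summit.ValiantsHypothesis.ValiantsHypothesis.Theorems.BarrierLever.AnchoredPeeling.DecRow k h (U.map σ.toEmbedding)) ∧
        (∀ W : Finset (Fin h), W ∈ Set.range w ↔ Summit.ValiantsHypothesis.ValiantsHypothesis.Theorems.BarrierLever.AnchoredPeeling.DecCol k h (W.map τ.toEmbedding))) →
    (¬ ∃ (k : ℕ) (σ τ : Equiv.Perm (Fin h)), 1 ≤ k ∧ 2 * k + 1 ≤ h ∧ 2 ^ (k + 1) - 1 ≤ h ∧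
        (∀ U : Finset (Fin h), U ∈ Set.range w ↔ Summit.ValiantsHypothesis.ValiantsHypothesis.Theorems.BarrierLever.AnchoredPeeling.DecRow k h (U.map σ.toEmbedding)) ∧
        (∀ W : Finset (Fin h), W ∈ Set.range u ↔ Summit.ValiantsHypothesis.ValiantsHypothesis.Theorems.BarrierLever.AnchoredPeeling.DecCol k h (W.map τ.toEmbedding))) →
    (¬ ∃ (m : ℕ) (σ τ : Equiv.Perm (Fin h)), 1 ≤ m ∧ 2 * m + 2 ≤ h ∧ 2 ^ (m + 1) + 2 ^ m - 1 ≤ h ∧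
        (∀ U : Finset (Fin h), U ∈ Set.range u ↔ Summit.ValiantsHypothesis.ValiantsHypothesis.Theorems.BarrierLever.AnchoredPeeling.SplitRow m h (U.map σ.toEmbedding)) ∧
        (∀ W : Finset (Fin h), W ∈ Set.range w ↔ Summit.ValiantsHypothesis.ValiantsHypothesis.Theorems.BarrierLever.AnchoredPeeling.SplitCol m h (W.map τ.toEmbedding))) →
    (¬ ∃ (m : ℕ) (σ τ : Equiv.Perm (Fin h)), 1 ≤ m ∧ 2 * m + 2 ≤ h ∧ 2 ^ (m + 1) + 2 ^ m - 1 ≤ h ∧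
        (∀ U : Finset (Fin h), U ∈ Set.range w ↔ Summit.ValiantsHypothesis.ValiantsHypothesis.Theorems.BarrierLever.AnchoredPeeling.SplitRow m h (U.map σ.toEmbedding)) ∧
        (∀ W : Finset (Fin h), W ∈ Set.range u ↔ Summit.ValiantsHypothesis.ValiantsHypothesis.Theorems.BarrierLever.AnchoredPeeling.SplitCol m h (W.map τ.toEmbedding))) →
    ¬ IsWApexPair u w → ¬ IsWApexPair w u →
    symbolicDet s h r u w ≠ 0

/-- **Kernel glue (weakest-node swap candidate): the registered residual minus weighted apex pairs ⟹ the registered residual.** -/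
theorem stub_ltRestNonCanonRS_of_rsw (hW : Stmt.stub_ltRestNonCanonRSW) : Stmt.stub_ltRestNonCanonRS := by
  obtain ⟨s, h₀, hs, hW⟩ := hW
  refine ⟨s, h₀, hs, fun h hh r u w hu hw hlu hlw hr hx hy ha1 ha2 hl1 hl2 hc1 hc2 hs1 hs2 => ?_⟩
  by_cases hrx : IsWApexPair u w
  · exact symbolicDet_ne_zero_of_isWApexPair hs hw hrx
  · by_cases hry : IsWApexPair w u
    · exact (symbolicDet_ne_zero_comm s h r u w).mpr (symbolicDet_ne_zero_of_isWApexPair hs hu hry)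
    · exact hW h hh r u w hu hw hlu hlw hr hx hy ha1 ha2 hl1 hl2 hc1 hc2 hs1 hs2 hrx hry

end

end Summit.ValiantsHypothesis.ValiantsHypothesis.Theorems.BarrierLever.AnchoredPeeling
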